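import Summits.NavierStokesRegularity.NavierStokesRegularity.Theorems.ScenarioCensusRowF1Inviscid
import HarnessLib

/-!
# LINE «inviscid-top» port, part 2/5: the `M`-normalised singular Type-I zoom package WITH HESSIANS (§3)

Re-homed for the scenario census (typer seat ns-census-typer-1 g8; the cells F1vfq ⊇ F1afq, F1vgq and the o-forms F1vf / F1vg / F1af are MEMBERS OF RECORD
«DECIDED IN KERNEL IN FILES» of row F1 since census v1.71 (critic idea-crit-3 PASS 21:40:30Z; ref ns-census-ref g8 PRE-CHECK ✓ §13.14 item 17; lead-presearch
label); this port makes them TREE-decided): VERBATIM PORT of ns-idea-3 LINE 18 «inviscid-top», `pub/ideators/ns-idea-3/lines/inviscid-top/line-inviscid-top.lean`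
sha16 75cdf592fc13b830 (1259 l., lean check rc 0, 0 sorry), split for the 400-line rule into `ScenarioCensusRowF1Inviscid` (§1–§2) → `…InviscidZoom` (§3) →
`…InviscidLiouville` (§4) → `…InviscidTransfer` (§5) → `…InviscidTop` (§6 + census KEYS).  Lean text VERBATIM in namespace `…Theorems.ScenarioCensus.InviscidTop`
(the line's `…Cruxes.ScenarioCensusRowF1.InviscidTopLine` re-homed); port edits: `@[conjecture]` on the residual `LaplacianDefectSlack` (≡ `ScenarioCensus.Row_F1`,
OPEN), fifteen one-line docstrings added (gate lint).

No census VALUE is moved here (row F1 stays OPEN-WITH-LINE; the members become TREE-decided by name); NS regularity is NOT proved; `Row_F1` is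
untouched (zero movement, `laplacianDefectSlack_iff_rowF1`); no summit statement is proved by this file. Lemmas that restate already-landed tree declarations are taken BY NAME (gate lint `dedup.landed`): `tendsto_physicalTime` = `ColumnarTop.tendsto_physicalTime`, `eventually_fast` = `ColumnarTop.eventually_fast`, `sqrt_timeLag` = `StretchedTop.sqrt_timeLag`, `forall_of_forall_ne_zero` = `StretchedTop.forall_of_forall_ne_zero`.
-/

-- the summit and its single problem share the name `NavierStokesRegularity` (D-0017 nested layout)
set_option linter.dupNamespace false

noncomputable section

open MeasureTheory Set Function Filter TopologicalSpace Metric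
open scoped Topology NNReal ENNReal InnerProductSpace RealInnerProductSpace Laplacian

namespace Summit.NavierStokesRegularity.NavierStokesRegularity.Theorems.ScenarioCensus.InviscidTop

open Literature.Analysis Literature.Analysis.FluidPDE
open Summit.NavierStokesRegularity.NavierStokesRegularity.Theorems

/-! ## §3 The `M`-normalised singular Type-I zoom package WITH HESSIANS -/

/-- **The singular Type-I zoom package with Hessians** (`M`-normalised): at a backward-singular point
`(T, x₀)` of a Type-I(`M`) Clay solution there are `α, β, R > 0` with `α R = β`, `α √ν = √β`, scales
`c_j ↓ 0` and a NONTRIVIAL `W ∈ 𝒦_M` with `(c_j α) u(T + c_j² β t, x₀ + c_j R y) → W(t, y)`,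
`(c_j α)(c_j R) ∇u(…) → ∇W(t, y)` AND `(c_j α)(c_j R)² ∇²u(…) → ∇²W(t, y)` pointwise on the open past.
(refs: AlbrittonBarker2019 §3; KochNadirashviliSereginSverak2009 Lemma 6.1, (4.10)) -/
theorem exists_singularZoom_package₂ {ν T M : ℝ} (hν : 0 < ν) (hT : 0 < T)
    {u : ℝ → E3 → E3} {p : ℝ → E3 → ℝ}
    (hsol : IsClassicalNSSolutionOn (Ico 0 T) ν 0 u p) (hLH : IsLerayHopfOn T ν 0 (u 0) u)
    (hdec : HasRapidSpatialDecay (u 0)) (hMν : IsTypeIBlowupWith M ν u T) (x₀ : E3)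
    (hsing : ∀ r : ℝ, 0 < r →
      eLpNorm (uncurry u) ∞ (volume.restrict (parabolicCylinder r ((T : ℝ), x₀))) = ∞) :
    ∃ (α β R : ℝ) (c : ℕ → ℝ) (W : ℝ → E3 → E3),
      0 < α ∧ 0 < β ∧ 0 < R ∧ α * R = β ∧ α * Real.sqrt ν = Real.sqrt β ∧
      (∀ j, 0 < c j) ∧ Tendsto c atTop (𝓝 0) ∧
      IsTypeIAncientMild M W ∧
      (∀ t < 0, ∀ y : E3,
        Tendsto (fun j => (c j * α) • u (T + c j ^ 2 * β * t) (x₀ + (c j * R) • y)) atTop (𝓝 (W t y))) ∧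
      (∀ t < 0, ∀ y : E3,
        Tendsto (fun j => (c j * α * (c j * R)) • fderiv ℝ (u (T + c j ^ 2 * β * t)) (x₀ + (c j * R) • y))
          atTop (𝓝 (fderiv ℝ (W t) y))) ∧
      (∀ t < 0, ∀ y : E3,
        Tendsto (fun j => (c j * α * (c j * R) * (c j * R)) •
            fderiv ℝ (fderiv ℝ (u (T + c j ^ 2 * β * t))) (x₀ + (c j * R) • y))
          atTop (𝓝 (fderiv ℝ (fderiv ℝ (W t)) y))) ∧
      ∃ t < 0, ∃ y, W t y ≠ 0 := by
  -- ## (1) the Type-I(`M`) rate window, the Morrey bound and the unit zoom at `(T, x₀)`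
  have hTI : IsTypeIBlowup u T := hMν.isTypeIBlowup
  obtain ⟨T₂, hT₂, hsub⟩ := (mem_nhdsLT_iff_exists_Ioo_subset).1 hMν
  set δ : ℝ := min (T - T₂) T with hδdef
  have hδ : 0 < δ := lt_min (sub_pos.2 hT₂) hT
  have hδT : δ ≤ T := min_le_right _ _
  have hrate : ∀ t ∈ Ioo (T - δ) T, ∀ x, Real.sqrt (T - t) * ‖u t x‖ ≤ M * Real.sqrt ν := by
    intro t ht x
    have h1 : δ ≤ T - T₂ := min_le_left _ _
    have ht2 : T₂ < t := by linarith [ht.1]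
    exact hsub ⟨ht2, ht.2⟩ x
  obtain ⟨r₀, M₀, T₁, hr₀, hT₁, hMor⟩ := morrey_of_typeI hν hT hsol hLH hTI
  obtain ⟨R, α, β, hR, hα, hβ, hβeq, hαeq, hβT, hball, hGv, htypeI⟩ :=
    exists_zoom_typeIBound_lt_top_of_morrey hν hT hsol hLH hr₀ hT₁ hMor x₀
  have hαR : α * R = β := by
    rw [hαeq, hβeq]
    ring
  have hsν : 0 < Real.sqrt ν := Real.sqrt_pos.2 hν
  have hαν : α * Real.sqrt ν = Real.sqrt β := by
    rw [hαeq, hβeq, Real.sqrt_div (sq_nonneg R), Real.sqrt_sq hR.le, div_mul_eq_mul_div,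
      div_eq_div_iff hν.ne' hsν.ne', mul_assoc, Real.mul_self_sqrt hν.le]
  set v : ℝ → E3 → E3 := α • stPull β R T x₀ u with hv
  set πv : ℝ → E3 → ℝ :=
    α ^ 2 • stPull β R T x₀ (fun t x => p t x - (p t 0 - normalisedPressure (u t) 0)) with hπv
  set Gv : ℝ → E3 → E3 →L[ℝ] E3 :=
    (α * R) • stPull β R T x₀ (fun t x => fderiv ℝ (u t) x) with hGvdef
  set I₀ : ℝ≥0∞ := typeIBound (parabolicCylinder (1 / 2) (0 : ℝ × E3)) v πv Gv with hI₀
  have hI₀top : I₀ ≠ ⊤ := htypeI.ne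
  -- ## (2) the scales `c k = 1/(k+4) ↓ 0` and the zoom sequence
  set c : ℕ → ℝ := fun k => 1 / ((k : ℝ) + 4) with hc
  have hcpos : ∀ k, 0 < c k := fun k => by simp only [hc]; positivity
  have hc4 : ∀ k, c k ≤ 1 / 4 := fun k =>
    div_le_div_of_nonneg_left zero_le_one (by norm_num) (by linarith [(Nat.cast_nonneg k : (0 : ℝ) ≤ k)])
  have hc2 : ∀ k, c k ≤ 1 / 2 := fun k => (hc4 k).trans (by norm_num)
  have hclim : Tendsto c atTop (𝓝 0) :=
    tendsto_const_nhds.div_atTop (tendsto_atTop_add_const_right _ _ tendsto_natCast_atTop_atTop)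
  set w : ℕ → ℝ → E3 → E3 :=
    fun k => (c k * α) • stPull (c k ^ 2 * β) (c k * R) T x₀ u with hw
  set Aw : ℕ → ℝ := fun k => -(δ / (c k ^ 2 * β)) with hA
  have hAk : ∀ k, Aw k = -(δ / β * ((k : ℝ) + 4) ^ 2) := by
    intro k
    simp only [hA, hc]
    field_simp
  have hAlim : Tendsto Aw atTop atBot := by
    have h1 : Tendsto (fun k : ℕ => ((k : ℝ) + 4) ^ 2) atTop atTop :=
      (tendsto_pow_atTop two_ne_zero).comp
        (tendsto_atTop_add_const_right _ _ tendsto_natCast_atTop_atTop)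
    have h2 : Tendsto (fun k : ℕ => δ / β * ((k : ℝ) + 4) ^ 2) atTop atTop :=
      h1.const_mul_atTop (by positivity)
    refine (tendsto_neg_atTop_atBot.comp h2).congr fun k => ?_
    rw [hAk k]
    rfl
  -- ## (3) per-scale facts
  have hcW : ∀ k, ContinuousOn (uncurry (w k)) (Ioo (Aw k) 0 ×ˢ univ) := fun k =>
    zoom_continuousOn hν hsol hR hαeq hβeq (hcpos k) hδT
  have hdivW : ∀ k, ∀ t ∈ Ioo (Aw k) 0, IsWeaklyDivFree (w k t) := fun k t ht =>
    zoom_isWeaklyDivFree hν hsol hR hαeq hβeq (hcpos k) hδT ht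
  have hmildW : ∀ k, ∀ s t : ℝ, Aw k < s → s < t → t < 0 → ∀ y,
      w k t y = UnboundedOperators.heatExtension (w k s) (t - s) y -
        oseenDuhamel 1 s (w k) (w k) t y := fun k s t hs hst ht y =>
    zoom_oseen hν hT hsol hLH hdec hR hαeq hβeq (hcpos k) hδT hs hst ht y
  set C₁ : ℝ := α * (M * Real.sqrt ν) / Real.sqrt β with hC₁
  have hC₁M : C₁ = M := by
    rw [hC₁, ← hαν]
    field_simp
  have hIW : ∀ k, ∀ t ∈ Ioo (Aw k) 0, ∀ y, ‖w k t y‖ ≤ C₁ / Real.sqrt (-t) := fun k t ht y =>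
    zoom_norm_le hR hαeq hβeq hν (hcpos k) hδT hrate ht y
  -- ## (4) extraction of the `C¹_loc` limit `W ∈ 𝒦_{C₁} = 𝒦_M`, then the Hessian upgrade (§2)
  obtain ⟨φ, hφ, W, hWclass, hpt, hgrad, -, -⟩ :=
    exists_tendsto_of_typeI_seq_Ioo C₁ hAlim hcW hdivW hmildW hIW
  have hφt : Tendsto φ atTop atTop := hφ.tendsto_atTop
  have hhess := tendsto_fderiv_fderiv_of_typeI_seq_Ioo (C := C₁) (hAlim.comp hφt)
    (fun j => hcW (φ j)) (fun j => hdivW (φ j)) (fun j => hmildW (φ j)) (fun j => hIW (φ j))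
    hWclass hgrad
  rw [hC₁M] at hWclass
  have hcφ : Tendsto (fun j => c (φ j)) atTop (𝓝 0) := hclim.comp hφt
  -- ## (5) `W` is unbounded at the origin
  have hsingW : ∀ r > 0, ∀ M' : ℝ, ∃ t ∈ Ioo (-(r ^ 2)) (0 : ℝ),
      ∃ x ∈ ball (0 : E3) r, M' < ‖W t x‖ :=
    zoomSeq_unbounded_at_origin (πv := πv) hsol hR hα hβ hβT hsing hball hGv hI₀top
      (fun j => hcpos (φ j)) (fun j => hc2 (φ j)) fun z hz =>
        hpt z.1 ((SuitableCompactness.mem_parabolicCylinder_zero.1 hz).1.2) z.2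
  have hwu : ∀ (j : ℕ) (t : ℝ) (y : E3),
      w (φ j) t y = (c (φ j) * α) • u (T + c (φ j) ^ 2 * β * t) (x₀ + (c (φ j) * R) • y) :=
    fun j t y => by simp only [hw, smul_stPull_apply]
  have hwD : ∀ (j : ℕ) (t : ℝ) (y : E3),
      fderiv ℝ (w (φ j) t) y = (c (φ j) * α * (c (φ j) * R)) •
        fderiv ℝ (u (T + c (φ j) ^ 2 * β * t)) (x₀ + (c (φ j) * R) • y) := by
    intro j t y
    have e1 : w (φ j) t = ((c (φ j) * α) • stPull (c (φ j) ^ 2 * β) (c (φ j) * R) T x₀ u) t := by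
      simp only [hw]
    rw [e1, fderiv_smul_stPull_apply]
  have hwDD : ∀ (j : ℕ) (t : ℝ) (y : E3),
      fderiv ℝ (fderiv ℝ (w (φ j) t)) y = (c (φ j) * α * (c (φ j) * R) * (c (φ j) * R)) •
        fderiv ℝ (fderiv ℝ (u (T + c (φ j) ^ 2 * β * t))) (x₀ + (c (φ j) * R) • y) := by
    intro j t y
    have e1 : w (φ j) t = ((c (φ j) * α) • stPull (c (φ j) ^ 2 * β) (c (φ j) * R) T x₀ u) t := by
      simp only [hw]
    rw [e1, fderiv_fderiv_smul_stPull]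
  -- ## (6) package
  obtain ⟨ts, hts, xs, -, hM'⟩ := hsingW 1 one_pos 0
  have hne : W ts xs ≠ 0 := by
    intro h0; rw [h0, norm_zero] at hM'; exact lt_irrefl _ hM'
  exact ⟨α, β, R, fun j => c (φ j), W, hα, hβ, hR, hαR, hαν, fun j => hcpos _, hcφ, hWclass,
    fun t ht y => (hpt t ht y).congr fun j => hwu j t y,
    fun t ht y => (hgrad t ht y).congr fun j => hwD j t y,
    fun t ht y => (hhess t ht y).congr fun j => hwDD j t y, ts, hts.2, xs, hne⟩

end Summit.NavierStokesRegularity.NavierStokesRegularity.Theorems.ScenarioCensus.InviscidTop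

end
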